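import Mathlib
import HarnessLib
import Summits.ValiantsHypothesis.ValiantsHypothesis.Theses.MonotoneRestoration
import Literature.Computability.AlgebraicComplexity.ArithCircuit
import Literature.Computability.AlgebraicComplexity.ArithCircuitProofs
import Literature.Computability.AlgebraicComplexity.MonotoneStructure
import Literature.Computability.AlgebraicComplexity.PermanentIrreducible
import Literature.ModelTheory.FiniteModelTheory.CkEquiv
import Summits.ValiantsHypothesis.ValiantsHypothesis.Theorems.MonotoneRestorationMonotoneRestorationQPCosetCount
import Summits.ValiantsHypothesis.ValiantsHypothesis.Theorems.MonotoneRestorationMonotoneRestorationQPSymmetricLB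
import Summits.ValiantsHypothesis.ValiantsHypothesis.Theorems.MonotoneRestorationMonotoneRestorationQPSupportSymmetrisation
import Summits.ValiantsHypothesis.ValiantsHypothesis.Theorems.MonotoneRestorationMonotoneRestorationQPSparseRegime
import Summits.ValiantsHypothesis.ValiantsHypothesis.Theorems.MonotoneRestorationMonotoneRestorationQPBeta
import Literature.Computability.AlgebraicComplexity.SymmetricArithCircuit
import Literature.Computability.AlgebraicComplexity.DawarWilsenach2025Proofs
import Literature.GroupTheory.PermutationGroups.SmallIndexSubgroups
import Summits.ValiantsHypothesis.ValiantsHypothesis.Theorems.MonotoneRestorationQP.Negative.LoadBearing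
import Summits.ValiantsHypothesis.ValiantsHypothesis.Theorems.MonotoneRestorationMonotoneRestorationQPPermSupportCount

/-! TTRL-lite variant V19342 of stmt-ValiantsHypothesis-15886 -/

-- `Summit.ValiantsHypothesis.ValiantsHypothesis.…` is the tree's mandated single-conjunct layout
-- (Sub = Summit), so the duplicated namespace component is intended.
set_option linter.dupNamespace false

namespace Summit.ValiantsHypothesis.ValiantsHypothesis.Theorems

open Summit.ValiantsHypothesis.ValiantsHypothesis.Theses.MonotoneRestoration
open Literature.Computability.AlgebraicComplexity

/-- TTRL-lite variant V19342 of `stmt-ValiantsHypothesis-15886` (the `hren` step): a monomial of a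
diagonally-invariant polynomial stays in the support after renaming by the (injective) diagonal
map `p ↦ (ρ p.1, ρ p.2)`; immediate from `MvPolynomial.coeff_rename_mapDomain`. -/
theorem stub_symmetricMonotone_choose_le_card_var19342 :
    ∀ (n : ℕ) (q : MvPolynomial (Fin n × Fin n) NNReal) (ρ : Equiv.Perm (Fin n))
      (m : Fin n × Fin n →₀ ℕ),
      MvPolynomial.rename (fun p : Fin n × Fin n => (ρ p.1, ρ p.2)) q = q → m ∈ q.support →
        Finsupp.mapDomain (fun p : Fin n × Fin n => (ρ p.1, ρ p.2)) m ∈ q.support := by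
  intro n q ρ m hq hm
  have hinj : Function.Injective (fun p : Fin n × Fin n => (ρ p.1, ρ p.2)) := by
    intro a b hab
    simp only [Prod.mk.injEq] at hab
    exact Prod.ext (ρ.injective hab.1) (ρ.injective hab.2)
  rw [MvPolynomial.mem_support_iff] at hm ⊢
  have key := MvPolynomial.coeff_rename_mapDomain (fun p : Fin n × Fin n => (ρ p.1, ρ p.2)) hinj q m
  rw [hq] at key
  rw [key]
  exact hm

end Summit.ValiantsHypothesis.ValiantsHypothesis.Theorems
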